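import Literature.Topology.FourManifolds.RadialExtension
import Literature.Topology.FourManifolds.DiscTheoremDiffeotopy
import Literature.Topology.FourManifolds.OrientedConnectedSumExistence
import Literature.Topology.FourManifolds.SmoothOrientationSphereProofs
import Literature.Topology.FourManifolds.EquidimensionalEmbedding
import Literature.Topology.FourManifolds.ConnectedSumData
import Literature.Topology.FourManifolds.ImmersionCriterion
import Literature.Topology.FourManifolds.ImmersionOrientation
import Literature.Topology.FourManifolds.BallStretch
import Literature.Topology.FourManifolds.BallFaceAlignment
import Literature.Topology.FourManifolds.CerfTheoremOne
import Literature.Topology.FourManifolds.CapGermExtension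
import Mathlib.Analysis.InnerProductSpace.Projection.FiniteDimensional
import HarnessLib

/-!
# Cap germ alignment: a ball-preserving map near the closed ball equal to a given diffeomorphism near a cap

Topic `Literature/Topology/FourManifolds`; the cap germ alignment for the fact seat
`provefact-Literature.Topology.FourManifolds.SphereEmbedding.schoenflies_exists_ball` (Alexander;
"standard model of a neighbourhood of the ball", Schultens (2014), Lemma 3.2.3, PDF pp. 42–43),
relative to a boundary disc.  **Everything in this file is proved; no definitions, no named
facts.**

* §1 `CapGermAlignment.coe_chartAt_symm_reflection` — the inverse stereographic chart at `u` is
  equivariant under the reflection of `ℝⁿ⁺¹` in a hyperplane `vᗮ` with `v ⊥ u`: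
  `σᵤ⁻¹ (L z) = R_v (σᵤ⁻¹ z)` for an isometry `L` of `ℝⁿ` of determinant `-1`.
* §2 `CapGermAlignment.exists_capEmbedding` — for `-1 < c₁ < c₀ < 1` a smooth embedding
  `j : ℝⁿ → 𝕊ⁿ` with open range in the open cap `{⟪u, x⟫ > c₁}`, `j(𝔻ⁿ)` the closed cap
  `{⟪u, x⟫ ≥ c₀}`, equivariant under `(L, R_v)`.
* §3 `CapGermAlignment.exists_lift` — the lift of `ι ∘ j` to `𝕊ⁿ` is a smooth embedding.
* §4 `CapGermAlignment.exists_normPreserving_apply_eq` — **a norm-preserving diffeomorphism `Q`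
  with `Q ∘ ι = id` on a closed cap** (disc theorem in `𝕊ⁿ` with a diffeotopy to the identity,
  `exists_isDiffeotopicToId_apply_disc_eq`, the orientation character corrected through the
  equivariance of `j`; radial extension `Diffeotopy.radialExtension`, Cerf's Lemme 2).
* §5 `CapGermAlignment.exists_alignment` — **the alignment**: a map smooth and injective near
  `𝔻̄ⁿ⁺¹` with smooth inverse, carrying the open ball onto itself and the sphere into itself, equal
  to `ι` near the sphere in the cone over a smaller cap (`CapBlend.exists_ballPreserving_extension`
  applied to `Q ∘ ι`, composed back with `Q⁻¹`).

## References
* M. W. Hirsch, *Differential Topology*, GTM 33 (1976), Ch. 8 §3 Thm. 3.1.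
* J. Schultens, *Introduction to 3-Manifolds*, GSM 151 (2014), Lemma 3.2.3, Thm. 3.2.5.
-/

open scoped RealInnerProductSpace Topology Manifold ContDiff
open Set Filter Metric Function Module

noncomputable section

namespace Literature.Topology.FourManifolds

namespace CapGermAlignment

variable {n : ℕ}

/-! ### §1 Equivariance of the inverse stereographic chart -/

/-- Reflection in the orthogonal complement of a unit vector: `R_w x = x - 2⟪w, x⟫ w`.
[folklore] -/
theorem reflection_orthogonal_singleton_apply {F : Type*} [NormedAddCommGroup F]
    [InnerProductSpace ℝ F] {w : F} (hw : ‖w‖ = 1) (x : F) :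
    (ℝ ∙ w)ᗮ.reflection x = x - (2 * ⟪w, x⟫) • w := by
  rw [Submodule.reflection_orthogonal_apply, Submodule.reflection_singleton_apply, hw]
  simp only [RCLike.ofReal_real_eq_id, id_eq, one_pow, div_one, neg_sub]
  norm_num
  rw [show (2:ℕ) • (⟪w, x⟫ • w) = (2 * ⟪w, x⟫) • w by rw [two_nsmul, ← add_smul]; ring_nf]

/-- **Equivariance of the inverse stereographic chart under a pole-fixing reflection.**  Let
`u ∈ 𝕊ⁿ`, `σ = chartAt u` (stereographic projection from `-u`) and `v` a unit vector with
`⟪u, v⟫ = 0`.  Then for some linear isometry `L` of `ℝⁿ` with `det L = -1`,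
`σ⁻¹ (L z) = R_v (σ⁻¹ z)` for all `z`, where `R_v` is the reflection of `ℝⁿ⁺¹` in `vᗮ` (`L` is
`R_v` restricted to `(-u)ᗮ`, read in the orthonormal frame of the chart). [folklore] -/
theorem coe_chartAt_symm_reflection (u : sphere (0 : (EuclideanSpace ℝ (Fin (n + 1)))) 1) {v : (EuclideanSpace ℝ (Fin (n + 1)))} (hv : ‖v‖ = 1)
    (huv : ⟪(u : (EuclideanSpace ℝ (Fin (n + 1)))), v⟫ = 0) :
    ∃ L : EuclideanSpace ℝ (Fin n) ≃ₗᵢ[ℝ] EuclideanSpace ℝ (Fin n),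
      LinearMap.det (L.toLinearEquiv : EuclideanSpace ℝ (Fin n) →ₗ[ℝ] EuclideanSpace ℝ (Fin n)) = -1 ∧
      ∀ z : EuclideanSpace ℝ (Fin n),
        (((chartAt (EuclideanSpace ℝ (Fin n)) u).symm (L z) : sphere (0 : (EuclideanSpace ℝ (Fin (n + 1)))) 1) : (EuclideanSpace ℝ (Fin (n + 1)))) =
          (ℝ ∙ v)ᗮ.reflection (((chartAt (EuclideanSpace ℝ (Fin n)) u).symm z : sphere (0 : (EuclideanSpace ℝ (Fin (n + 1)))) 1) : (EuclideanSpace ℝ (Fin (n + 1)))) := by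
  haveI : Fact (finrank ℝ (EuclideanSpace ℝ (Fin (n + 1))) = n + 1) := ⟨finrank_euclideanSpace_fin⟩
  set p : sphere (0 : (EuclideanSpace ℝ (Fin (n + 1)))) 1 := -u with hp
  have hp0 : (p : (EuclideanSpace ℝ (Fin (n + 1)))) ≠ 0 := ne_zero_of_mem_unit_sphere p
  have hpv : ⟪(p : (EuclideanSpace ℝ (Fin (n + 1)))), v⟫ = 0 := by
    rw [hp, coe_neg_sphere, inner_neg_left, huv, neg_zero]
  -- the orthonormal frame of the chart
  set U : (ℝ ∙ (p : (EuclideanSpace ℝ (Fin (n + 1)))))ᗮ ≃ₗᵢ[ℝ] EuclideanSpace ℝ (Fin n) :=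
    (OrthonormalBasis.fromOrthogonalSpanSingleton n (ne_zero_of_mem_unit_sphere p)).repr with hU
  -- `v` as an element of `pᗮ`
  have hvmem : v ∈ (ℝ ∙ (p : (EuclideanSpace ℝ (Fin (n + 1)))))ᗮ := Submodule.mem_orthogonal_singleton_iff_inner_right.2 hpv
  set v' : (ℝ ∙ (p : (EuclideanSpace ℝ (Fin (n + 1)))))ᗮ := ⟨v, hvmem⟩ with hv'
  have hv'n : ‖U v'‖ = 1 := by rw [LinearIsometryEquiv.norm_map, Submodule.coe_norm]; exact hv
  -- the isometry `L`
  set L : EuclideanSpace ℝ (Fin n) ≃ₗᵢ[ℝ] EuclideanSpace ℝ (Fin n) := (ℝ ∙ U v')ᗮ.reflection with hL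
  refine ⟨L, ?_, fun z => ?_⟩
  · have h := (ℝ ∙ U v')ᗮ.det_reflection
    have hne : U v' ≠ 0 := by
      intro h0; rw [h0, norm_zero] at hv'n; exact zero_ne_one hv'n
    rw [Submodule.orthogonal_orthogonal, finrank_span_singleton hne, pow_one] at h
    exact h
  -- `U.symm (L z) = R_v (U.symm z)` in `E`
  have hw : ∀ z : EuclideanSpace ℝ (Fin n), ((U.symm (L z) : (ℝ ∙ (p : (EuclideanSpace ℝ (Fin (n + 1)))))ᗮ) : (EuclideanSpace ℝ (Fin (n + 1)))) =
      (ℝ ∙ v)ᗮ.reflection ((U.symm z : (ℝ ∙ (p : (EuclideanSpace ℝ (Fin (n + 1)))))ᗮ) : (EuclideanSpace ℝ (Fin (n + 1)))) := by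
    intro z
    rw [hL, reflection_orthogonal_singleton_apply hv'n, reflection_orthogonal_singleton_apply hv,
      map_sub, map_smul]
    simp only [LinearIsometryEquiv.symm_apply_apply, Submodule.coe_sub, Submodule.coe_smul]
    congr 2
    rw [← LinearIsometryEquiv.inner_map_map U.symm, LinearIsometryEquiv.symm_apply_apply, Submodule.coe_inner]
  have hnorm : ∀ z : EuclideanSpace ℝ (Fin n), ‖((U.symm (L z) : (ℝ ∙ (p : (EuclideanSpace ℝ (Fin (n + 1)))))ᗮ) : (EuclideanSpace ℝ (Fin (n + 1))))‖ =
      ‖((U.symm z : (ℝ ∙ (p : (EuclideanSpace ℝ (Fin (n + 1)))))ᗮ) : (EuclideanSpace ℝ (Fin (n + 1))))‖ := fun z => by rw [hw, LinearIsometryEquiv.norm_map]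
  have hRp : (ℝ ∙ v)ᗮ.reflection (p : (EuclideanSpace ℝ (Fin (n + 1)))) = p :=
    Submodule.reflection_mem_subspace_eq_self (Submodule.mem_orthogonal_singleton_iff_inner_right.2
      (by rw [real_inner_comm]; exact hpv))
  have hc : chartAt (EuclideanSpace ℝ (Fin n)) u = stereographic' n p := rfl
  rw [hc, stereographic'_symm_apply, stereographic'_symm_apply]
  dsimp only
  rw [← hU, hnorm z, hw z]
  simp only [map_add, map_smul, hRp]

/-! ### §2 The standard cap embedding -/

/-- `ballStretch` commutes with linear isometries (it is a radial map). [folklore] -/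
theorem ballStretch_map_linearIsometryEquiv {F : Type*} [NormedAddCommGroup F] [InnerProductSpace ℝ F]
    (R : ℝ) (L : F ≃ₗᵢ[ℝ] F) (y : F) : ballStretch R (L y) = L (ballStretch R y) := by
  unfold ballStretch radialMap
  rw [LinearIsometryEquiv.norm_map, LinearIsometryEquiv.map_smul]

/-- The height of the inverse stereographic chart after a homothety: for `ρ₀ = 2√((1-c₀)/(1+c₀))`,
`c₀ ≤ ⟪u, σᵤ⁻¹(ρ₀ y)⟫ ↔ ‖y‖ ≤ 1` and `c₀ < ⟪u, σᵤ⁻¹(ρ₀ y)⟫ ↔ ‖y‖ < 1`. [folklore] -/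
theorem le_inner_chartAt_symm_smul_iff (u : sphere (0 : (EuclideanSpace ℝ (Fin (n + 1)))) 1) {c₀ : ℝ} (hc₀ : -1 < c₀) (hc₁ : c₀ < 1)
    (y : EuclideanSpace ℝ (Fin n)) :
    (c₀ ≤ ⟪(u : (EuclideanSpace ℝ (Fin (n + 1)))), (((chartAt (EuclideanSpace ℝ (Fin n)) u).symm
        ((2 * Real.sqrt ((1 - c₀) / (1 + c₀))) • y) : sphere (0 : (EuclideanSpace ℝ (Fin (n + 1)))) 1) : (EuclideanSpace ℝ (Fin (n + 1))))⟫ ↔ ‖y‖ ≤ 1) ∧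
    (c₀ < ⟪(u : (EuclideanSpace ℝ (Fin (n + 1)))), (((chartAt (EuclideanSpace ℝ (Fin n)) u).symm
        ((2 * Real.sqrt ((1 - c₀) / (1 + c₀))) • y) : sphere (0 : (EuclideanSpace ℝ (Fin (n + 1)))) 1) : (EuclideanSpace ℝ (Fin (n + 1))))⟫ ↔ ‖y‖ < 1) := by
  have h1c : 0 < 1 + c₀ := by linarith
  have h1c' : 0 < 1 - c₀ := by linarith
  set k : ℝ := (1 - c₀) / (1 + c₀) with hk
  have hkpos : 0 < k := div_pos h1c' h1c
  have hk1 : k * (1 + c₀) = 1 - c₀ := div_mul_cancel₀ _ h1c.ne'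
  set ρ₀ : ℝ := 2 * Real.sqrt k with hρ₀
  have hρ₀pos : 0 < ρ₀ := mul_pos two_pos (Real.sqrt_pos.2 hkpos)
  have hρ₀sq : ρ₀ ^ 2 = 4 * k := by
    rw [hρ₀, mul_pow, Real.sq_sqrt hkpos.le]; norm_num
  rw [BallFaceAlignment.inner_chartAt_symm, norm_smul, Real.norm_eq_abs, abs_of_pos hρ₀pos, mul_pow, hρ₀sq]
  have hq : 0 < 4 + 4 * k * ‖y‖ ^ 2 := by positivity
  have hkt : k * ‖y‖ ^ 2 * (1 + c₀) = ‖y‖ ^ 2 * (1 - c₀) := by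
    rw [mul_comm k, mul_assoc, hk1]
  constructor
  · rw [le_div_iff₀ hq, ← sq_le_one_iff₀ (norm_nonneg y)]
    constructor
    · intro h
      have h2 : ‖y‖ ^ 2 * (1 - c₀) ≤ 1 * (1 - c₀) := by nlinarith
      exact le_of_mul_le_mul_right h2 h1c'
    · intro h
      have h2 : ‖y‖ ^ 2 * (1 - c₀) ≤ 1 * (1 - c₀) := mul_le_mul_of_nonneg_right h h1c'.le
      nlinarith
  · rw [lt_div_iff₀ hq, ← sq_lt_one_iff₀ (norm_nonneg y)]
    constructor
    · intro h
      have h2 : ‖y‖ ^ 2 * (1 - c₀) < 1 * (1 - c₀) := by nlinarith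
      exact lt_of_mul_lt_mul_right h2 h1c'.le
    · intro h
      have h2 : ‖y‖ ^ 2 * (1 - c₀) < 1 * (1 - c₀) := mul_lt_mul_of_pos_right h h1c'
      nlinarith

/-- **The standard cap embedding.**  For `u ∈ 𝕊ⁿ`, a unit vector `v ⊥ u`, and
`-1 < c₁ < c₀ < 1`, there are a smooth embedding `j : ℝⁿ → 𝕊ⁿ` with open range inside the open
cap `{⟪u, x⟫ > c₁}`, mapping the closed unit disc onto the closed cap `{⟪u, x⟫ ≥ c₀}`, and a
linear isometry `L` of `ℝⁿ` with `det L = -1` such that `j (L y) = R_v (j y)` (`R_v` the reflection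
in `vᗮ`): `j = σᵤ⁻¹ ∘ (ρ₀ •) ∘ ballStretch (ρ₁/ρ₀)`. [folklore] -/
theorem exists_capEmbedding (u : sphere (0 : (EuclideanSpace ℝ (Fin (n + 1)))) 1) {v : (EuclideanSpace ℝ (Fin (n + 1)))} (hv : ‖v‖ = 1)
    (huv : ⟪(u : (EuclideanSpace ℝ (Fin (n + 1)))), v⟫ = 0) {c₁ c₀ : ℝ} (hc₁ : -1 < c₁) (hc : c₁ < c₀) (hc₀ : c₀ < 1) :
    ∃ (j : EuclideanSpace ℝ (Fin n) → sphere (0 : (EuclideanSpace ℝ (Fin (n + 1)))) 1)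
      (L : EuclideanSpace ℝ (Fin n) ≃ₗᵢ[ℝ] EuclideanSpace ℝ (Fin n)),
      Manifold.IsSmoothEmbedding 𝓘(ℝ, EuclideanSpace ℝ (Fin n)) (𝓡 n) ∞ j ∧ IsOpen (range j) ∧
      (∀ y, c₁ < ⟪(u : (EuclideanSpace ℝ (Fin (n + 1)))), (j y : (EuclideanSpace ℝ (Fin (n + 1))))⟫) ∧
      (↑) '' (j '' closedBall (0 : EuclideanSpace ℝ (Fin n)) 1) = {x : (EuclideanSpace ℝ (Fin (n + 1))) | ‖x‖ = 1 ∧ c₀ ≤ ⟪(u : (EuclideanSpace ℝ (Fin (n + 1)))), x⟫} ∧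
      LinearMap.det (L.toLinearEquiv : EuclideanSpace ℝ (Fin n) →ₗ[ℝ] EuclideanSpace ℝ (Fin n)) = -1 ∧
      ∀ y, ((j (L y) : sphere (0 : (EuclideanSpace ℝ (Fin (n + 1)))) 1) : (EuclideanSpace ℝ (Fin (n + 1)))) = (ℝ ∙ v)ᗮ.reflection (j y : (EuclideanSpace ℝ (Fin (n + 1)))) := by
  haveI : Fact (finrank ℝ (EuclideanSpace ℝ (Fin (n + 1))) = n + 1) := ⟨finrank_euclideanSpace_fin⟩
  have h0c : -1 < c₀ := by linarith
  have h1c : c₁ < 1 := by linarith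
  set k₀ : ℝ := (1 - c₀) / (1 + c₀) with hk₀
  set k₁ : ℝ := (1 - c₁) / (1 + c₁) with hk₁
  have hk₀pos : 0 < k₀ := div_pos (by linarith) (by linarith)
  have hk₁pos : 0 < k₁ := div_pos (by linarith) (by linarith)
  have hk₀₁ : k₀ < k₁ := by
    rw [hk₀, hk₁, div_lt_div_iff₀ (by linarith) (by linarith)]
    nlinarith
  set ρ₀ : ℝ := 2 * Real.sqrt k₀ with hρ₀
  set ρ₁ : ℝ := 2 * Real.sqrt k₁ with hρ₁
  have hρ₀pos : 0 < ρ₀ := mul_pos two_pos (Real.sqrt_pos.2 hk₀pos)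
  have hρ₁pos : 0 < ρ₁ := mul_pos two_pos (Real.sqrt_pos.2 hk₁pos)
  have hρ₀₁ : ρ₀ < ρ₁ := by
    rw [hρ₀, hρ₁]
    exact mul_lt_mul_of_pos_left (Real.sqrt_lt_sqrt hk₀pos.le hk₀₁) two_pos
  set R : ℝ := ρ₁ / ρ₀ with hR
  have hR1 : 1 < R := (one_lt_div hρ₀pos).2 hρ₀₁
  -- the chart and the homothety
  set c := chartAt (EuclideanSpace ℝ (Fin n)) u with hcdef
  have hct : c.target = univ := by
    rw [show c = stereographic' n (-u) from rfl, stereographic'_target]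
  have hemb : Manifold.IsSmoothEmbedding (𝓡 n) (𝓡 n) ∞ c.symm :=
    isSmoothEmbedding_symm_of_target_eq_univ (IsManifold.chart_mem_maximalAtlas u) hct
  let S : EuclideanSpace ℝ (Fin n) ≃ₘ⟮𝓘(ℝ, EuclideanSpace ℝ (Fin n)),
      𝓘(ℝ, EuclideanSpace ℝ (Fin n))⟯ EuclideanSpace ℝ (Fin n) :=
    { toFun := fun y => ρ₀ • y
      invFun := fun y => ρ₀⁻¹ • y
      left_inv := fun y => by simp [smul_smul, hρ₀pos.ne']
      right_inv := fun y => by simp [smul_smul, hρ₀pos.ne']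
      contMDiff_toFun := (contDiff_const_smul ρ₀).contMDiff
      contMDiff_invFun := (contDiff_const_smul ρ₀⁻¹).contMDiff }
  have hS : ∀ y, S y = ρ₀ • y := fun _ => rfl
  set i₀ : EuclideanSpace ℝ (Fin n) → sphere (0 : (EuclideanSpace ℝ (Fin (n + 1)))) 1 := c.symm ∘ S with hi₀
  have hi₀emb : Manifold.IsSmoothEmbedding 𝓘(ℝ, EuclideanSpace ℝ (Fin n)) (𝓡 n) ∞ i₀ :=
    hemb.comp_diffeomorph S
  have hi₀app : ∀ y, i₀ y = c.symm (ρ₀ • y) := fun y => rfl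
  -- the cap embedding
  set j : EuclideanSpace ℝ (Fin n) → sphere (0 : (EuclideanSpace ℝ (Fin (n + 1)))) 1 := i₀ ∘ ballStretch R with hj
  have hjemb : Manifold.IsSmoothEmbedding 𝓘(ℝ, EuclideanSpace ℝ (Fin n)) (𝓡 n) ∞ j :=
    hi₀emb.comp_ballStretch hR1
  have hjapp : ∀ y, j y = c.symm (ρ₀ • ballStretch R y) := fun y => rfl
  -- the isometry
  obtain ⟨L, hLdet, hLeq⟩ := coe_chartAt_symm_reflection u hv huv
  refine ⟨j, L, hjemb, ?_, fun y => ?_, ?_, hLdet, fun y => ?_⟩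
  · -- open range: `range j = i₀ '' ball 0 R`
    rw [hj, range_comp_ballStretch' hR1]
    exact (hi₀emb.isLocalDiffeomorph_of_finrank_eq rfl).isOpenMap _ isOpen_ball
  · -- range in the open cap
    rw [hjapp]
    have hb : ‖ballStretch R y‖ < R := norm_ballStretch_lt hR1 y
    -- `ρ₀ • b = ρ₁ • (R⁻¹ • b)` with `‖R⁻¹ • b‖ < 1`
    have heq : ρ₀ • ballStretch R y = ρ₁ • (R⁻¹ • ballStretch R y) := by
      rw [smul_smul, hR]; field_simp
    rw [heq]
    apply ((le_inner_chartAt_symm_smul_iff u hc₁ h1c _).2).2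
    rw [norm_smul, Real.norm_eq_abs, abs_of_pos (inv_pos.2 (by linarith)), inv_mul_lt_iff₀ (by linarith)]
    linarith
  · -- the closed cap
    have himg : j '' closedBall (0 : EuclideanSpace ℝ (Fin n)) 1 = i₀ '' closedBall 0 1 := by
      refine image_congr fun y hy => ?_
      show i₀ (ballStretch R y) = i₀ y
      rw [ballStretch_eq_self hR1 (mem_closedBall_zero_iff.1 hy)]
    rw [himg]
    apply Subset.antisymm
    · rintro x ⟨x', ⟨y, hy, rfl⟩, rfl⟩
      refine ⟨by simp [norm_eq_of_mem_sphere], ?_⟩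
      rw [hi₀app]
      exact ((le_inner_chartAt_symm_smul_iff u h0c hc₀ y).1).2 (mem_closedBall_zero_iff.1 hy)
    · rintro x ⟨hx1, hxc⟩
      have hxs : x ∈ sphere (0 : (EuclideanSpace ℝ (Fin (n + 1)))) 1 := by simpa using hx1
      set xs : sphere (0 : (EuclideanSpace ℝ (Fin (n + 1)))) 1 := ⟨x, hxs⟩ with hxs_def
      have hne : xs ≠ -u := by
        intro h
        have h' : x = -(u : (EuclideanSpace ℝ (Fin (n + 1)))) := by rw [← coe_neg_sphere, ← h]
        rw [h', inner_neg_right, real_inner_self_eq_norm_sq, norm_eq_of_mem_sphere, one_pow] at hxc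
        linarith
      have hsrc : xs ∈ c.source := by
        rw [show c = stereographic' n (-u) from rfl, stereographic'_source]; exact hne
      set y : EuclideanSpace ℝ (Fin n) := ρ₀⁻¹ • c xs with hy
      have hyx : c.symm (ρ₀ • y) = xs := by
        rw [hy, smul_smul, mul_inv_cancel₀ hρ₀pos.ne', one_smul, c.left_inv hsrc]
      refine ⟨xs, ⟨y, ?_, ?_⟩, rfl⟩
      · rw [mem_closedBall_zero_iff, ← (le_inner_chartAt_symm_smul_iff u h0c hc₀ y).1, hyx]
        exact hxc
      · rw [hi₀app, hyx]
  · -- equivariance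
    rw [hjapp, hjapp, ballStretch_map_linearIsometryEquiv, ← LinearIsometryEquiv.map_smul, hLeq]

/-! ### §3 Lifting `ι ∘ j` to the sphere -/

/-- **The lift of `ι ∘ j`.**  If the diffeomorphism `ι` of `ℝⁿ⁺¹` maps the part of the unit
sphere inside `W₁` into the unit sphere and `j : ℝⁿ → 𝕊ⁿ` is a smooth embedding with image in
`W₁`, then `y ↦ ι (j y)` is a smooth embedding `ℝⁿ → 𝕊ⁿ` (codomain restriction; injective
differential by the chain rule; `isImmersion_of_injective_mfderiv`). [folklore] -/
theorem exists_lift (ι : (EuclideanSpace ℝ (Fin (n + 1))) ≃ₘ⟮𝓘(ℝ, (EuclideanSpace ℝ (Fin (n + 1)))), 𝓘(ℝ, (EuclideanSpace ℝ (Fin (n + 1))))⟯ (EuclideanSpace ℝ (Fin (n + 1)))) {W₁ : Set (EuclideanSpace ℝ (Fin (n + 1)))}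
    (hsph : ∀ x ∈ W₁, ‖x‖ = 1 → ‖ι x‖ = 1)
    {j : EuclideanSpace ℝ (Fin n) → sphere (0 : (EuclideanSpace ℝ (Fin (n + 1)))) 1}
    (hj : Manifold.IsSmoothEmbedding 𝓘(ℝ, EuclideanSpace ℝ (Fin n)) (𝓡 n) ∞ j)
    (hjW : ∀ y, (j y : (EuclideanSpace ℝ (Fin (n + 1)))) ∈ W₁) :
    ∃ i : EuclideanSpace ℝ (Fin n) → sphere (0 : (EuclideanSpace ℝ (Fin (n + 1)))) 1,
      Manifold.IsSmoothEmbedding 𝓘(ℝ, EuclideanSpace ℝ (Fin n)) (𝓡 n) ∞ i ∧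
      ∀ y, (i y : (EuclideanSpace ℝ (Fin (n + 1)))) = ι (j y) := by
  haveI : Fact (finrank ℝ (EuclideanSpace ℝ (Fin (n + 1))) = n + 1) := ⟨finrank_euclideanSpace_fin⟩
  set g : EuclideanSpace ℝ (Fin n) → (EuclideanSpace ℝ (Fin (n + 1))) := fun y => ι (j y) with hg
  have hgs : ∀ y, g y ∈ sphere (0 : (EuclideanSpace ℝ (Fin (n + 1)))) 1 := fun y => by
    rw [mem_sphere_zero_iff_norm]
    exact hsph _ (hjW y) (by simp [norm_eq_of_mem_sphere])
  have hcj : ContMDiff 𝓘(ℝ, EuclideanSpace ℝ (Fin n)) 𝓘(ℝ, (EuclideanSpace ℝ (Fin (n + 1)))) ∞ (fun y => (j y : (EuclideanSpace ℝ (Fin (n + 1))))) :=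
    contMDiff_coe_sphere.comp hj.contMDiff
  have hgc : ContMDiff 𝓘(ℝ, EuclideanSpace ℝ (Fin n)) 𝓘(ℝ, (EuclideanSpace ℝ (Fin (n + 1)))) ∞ g := ι.contMDiff.comp hcj
  set i : EuclideanSpace ℝ (Fin n) → sphere (0 : (EuclideanSpace ℝ (Fin (n + 1)))) 1 := Set.codRestrict g _ hgs with hi
  have hic : ContMDiff 𝓘(ℝ, EuclideanSpace ℝ (Fin n)) (𝓡 n) ∞ i := hgc.codRestrict_sphere hgs
  have e2 : g = (↑) ∘ i := rfl
  -- injective differential of `coe ∘ j`, then of `g`, then of `i`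
  have hinj : ∀ y, Injective (mfderiv 𝓘(ℝ, EuclideanSpace ℝ (Fin n)) (𝓡 n) i y) := by
    intro y
    have hjd : MDifferentiableAt 𝓘(ℝ, EuclideanSpace ℝ (Fin n)) (𝓡 n) j y :=
      (hj.contMDiff y).mdifferentiableAt (by simp)
    have hcd0 : MDifferentiableAt (𝓡 n) 𝓘(ℝ, (EuclideanSpace ℝ (Fin (n + 1)))) ((↑) : sphere (0 : (EuclideanSpace ℝ (Fin (n + 1)))) 1 → (EuclideanSpace ℝ (Fin (n + 1)))) (j y) :=
      (contMDiff_coe_sphere (m := ∞) (j y)).mdifferentiableAt (by simp)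
    have hcjd : MDifferentiableAt 𝓘(ℝ, EuclideanSpace ℝ (Fin n)) 𝓘(ℝ, (EuclideanSpace ℝ (Fin (n + 1)))) (fun y => (j y : (EuclideanSpace ℝ (Fin (n + 1))))) y :=
      (hcj y).mdifferentiableAt (by simp)
    have hιd : MDifferentiableAt 𝓘(ℝ, (EuclideanSpace ℝ (Fin (n + 1)))) 𝓘(ℝ, (EuclideanSpace ℝ (Fin (n + 1)))) ι (j y : (EuclideanSpace ℝ (Fin (n + 1)))) := (ι.contMDiff _).mdifferentiableAt (by simp)
    have hid : MDifferentiableAt 𝓘(ℝ, EuclideanSpace ℝ (Fin n)) (𝓡 n) i y := (hic y).mdifferentiableAt (by simp)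
    have hcd : MDifferentiableAt (𝓡 n) 𝓘(ℝ, (EuclideanSpace ℝ (Fin (n + 1)))) ((↑) : sphere (0 : (EuclideanSpace ℝ (Fin (n + 1)))) 1 → (EuclideanSpace ℝ (Fin (n + 1)))) (i y) :=
      (contMDiff_coe_sphere (m := ∞) (i y)).mdifferentiableAt (by simp)
    -- `coe ∘ j`
    have h0 : Injective (mfderiv 𝓘(ℝ, EuclideanSpace ℝ (Fin n)) 𝓘(ℝ, (EuclideanSpace ℝ (Fin (n + 1)))) (fun y => (j y : (EuclideanSpace ℝ (Fin (n + 1))))) y) := by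
      have := mfderiv_comp y hcd0 hjd (f := j) (g := ((↑) : sphere (0 : (EuclideanSpace ℝ (Fin (n + 1)))) 1 → (EuclideanSpace ℝ (Fin (n + 1)))))
      rw [show (((↑) : sphere (0 : (EuclideanSpace ℝ (Fin (n + 1)))) 1 → (EuclideanSpace ℝ (Fin (n + 1)))) ∘ j) = fun y => (j y : (EuclideanSpace ℝ (Fin (n + 1)))) from rfl] at this
      rw [this, ContinuousLinearMap.coe_comp]
      exact (mfderiv_coe_sphere_injective (n := n) (j y)).comp
        (injective_mfderiv_of_isImmersionAt' (hj.isImmersion.isImmersionAt y))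
    -- `ι` is a diffeomorphism: injective differential
    have hιinj : Injective (mfderiv 𝓘(ℝ, (EuclideanSpace ℝ (Fin (n + 1)))) 𝓘(ℝ, (EuclideanSpace ℝ (Fin (n + 1)))) ι (j y : (EuclideanSpace ℝ (Fin (n + 1))))) := by
      have hsd : MDifferentiableAt 𝓘(ℝ, (EuclideanSpace ℝ (Fin (n + 1)))) 𝓘(ℝ, (EuclideanSpace ℝ (Fin (n + 1)))) ι.symm (ι (j y : (EuclideanSpace ℝ (Fin (n + 1))))) :=
        (ι.symm.contMDiff _).mdifferentiableAt (by simp)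
      have hcomp := mfderiv_comp (j y : (EuclideanSpace ℝ (Fin (n + 1)))) hsd hιd (f := ι) (g := ι.symm)
      have hid' : (ι.symm ∘ ι) = id := funext fun x => ι.symm_apply_apply x
      rw [hid', mfderiv_id] at hcomp
      intro a b hab
      have ha : a = mfderiv 𝓘(ℝ, (EuclideanSpace ℝ (Fin (n + 1)))) 𝓘(ℝ, (EuclideanSpace ℝ (Fin (n + 1)))) ι.symm (ι (j y : (EuclideanSpace ℝ (Fin (n + 1))))) (mfderiv 𝓘(ℝ, (EuclideanSpace ℝ (Fin (n + 1)))) 𝓘(ℝ, (EuclideanSpace ℝ (Fin (n + 1)))) ι (j y : (EuclideanSpace ℝ (Fin (n + 1)))) a) :=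
        congrArg (fun T : (EuclideanSpace ℝ (Fin (n + 1))) →L[ℝ] (EuclideanSpace ℝ (Fin (n + 1))) => T a) hcomp
      have hb : b = mfderiv 𝓘(ℝ, (EuclideanSpace ℝ (Fin (n + 1)))) 𝓘(ℝ, (EuclideanSpace ℝ (Fin (n + 1)))) ι.symm (ι (j y : (EuclideanSpace ℝ (Fin (n + 1))))) (mfderiv 𝓘(ℝ, (EuclideanSpace ℝ (Fin (n + 1)))) 𝓘(ℝ, (EuclideanSpace ℝ (Fin (n + 1)))) ι (j y : (EuclideanSpace ℝ (Fin (n + 1)))) b) :=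
        congrArg (fun T : (EuclideanSpace ℝ (Fin (n + 1))) →L[ℝ] (EuclideanSpace ℝ (Fin (n + 1))) => T b) hcomp
      rw [ha, hb, hab]
    -- `g = ι ∘ (coe ∘ j)`
    have h1 : Injective (mfderiv 𝓘(ℝ, EuclideanSpace ℝ (Fin n)) 𝓘(ℝ, (EuclideanSpace ℝ (Fin (n + 1)))) g y) := by
      have := mfderiv_comp y hιd hcjd (f := fun y => (j y : (EuclideanSpace ℝ (Fin (n + 1))))) (g := ι)
      rw [show (ι ∘ fun y => (j y : (EuclideanSpace ℝ (Fin (n + 1))))) = g from rfl] at this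
      rw [this, ContinuousLinearMap.coe_comp]
      exact hιinj.comp h0
    rw [e2, mfderiv_comp y hcd hid] at h1
    exact Injective.of_comp h1
  have himm : Manifold.IsImmersion 𝓘(ℝ, EuclideanSpace ℝ (Fin n)) (𝓡 n) ∞ i :=
    isImmersion_of_injective_mfderiv hic (by simp) hinj
  have hemb : Topology.IsEmbedding i := by
    rw [← Topology.IsEmbedding.subtypeVal.of_comp_iff, ← e2]
    exact ι.toHomeomorph.isEmbedding.comp (Topology.IsEmbedding.subtypeVal.comp hj.isEmbedding)
  exact ⟨i, ⟨himm, hemb⟩, fun y => rfl⟩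

/-! ### §4 A norm-preserving diffeomorphism undoing `ι` on a closed cap -/

/-- **Undoing `ι` on a closed cap by a norm-preserving diffeomorphism.**  Let `ι` be a
diffeomorphism of `ℝⁿ⁺¹` (`n ≠ 0`) mapping the part of the unit sphere inside `W₁` into the unit
sphere, where `W₁` contains the cap `{‖x‖ = 1, ⟪u, x⟫ > c₁}`, and let `c₁ < c₀ < 1`.  Then some
diffeomorphism `Q` of `ℝⁿ⁺¹` with `‖Q x‖ = ‖x‖` satisfies `Q (ι x) = x` on the closed cap
`{‖x‖ = 1, ⟪u, x⟫ ≥ c₀}`.  Proof: with the standard cap embedding `j` (`exists_capEmbedding`)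
and the lift `î` of `ι ∘ j` (`exists_lift`), the disc theorem in `𝕊ⁿ`
(`exists_isDiffeotopicToId_apply_disc_eq`) gives `f ∈ Diff(𝕊ⁿ)` diffeotopic to `id` with
`f ∘ î = j` on `𝔻ⁿ` when `î` has the orientation character of `j`; otherwise it is applied to
`î ∘ L` (`det L = -1`), giving `f ∘ î = R_v` on the cap by the equivariance of `j`; then
`Q = P̃` or `Q = R_v ∘ P̃` with `P̃` the radial extension of the diffeotopy
(`Diffeotopy.radialExtension`). [cite: HirschDT1976, Ch. 8 §3, Thm. 3.1] -/
theorem exists_normPreserving_apply_eq (hn : n ≠ 0) (u : sphere (0 : (EuclideanSpace ℝ (Fin (n + 1)))) 1) {c₁ c₀ : ℝ}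
    (hc₁ : -1 < c₁) (hc : c₁ < c₀) (hc₀ : c₀ < 1)
    (ι : (EuclideanSpace ℝ (Fin (n + 1))) ≃ₘ⟮𝓘(ℝ, (EuclideanSpace ℝ (Fin (n + 1)))), 𝓘(ℝ, (EuclideanSpace ℝ (Fin (n + 1))))⟯ (EuclideanSpace ℝ (Fin (n + 1)))) {W₁ : Set (EuclideanSpace ℝ (Fin (n + 1)))}
    (hsph : ∀ x ∈ W₁, ‖x‖ = 1 → ‖ι x‖ = 1)
    (hcapW : ∀ x : (EuclideanSpace ℝ (Fin (n + 1))), ‖x‖ = 1 → c₁ < ⟪(u : (EuclideanSpace ℝ (Fin (n + 1)))), x⟫ → x ∈ W₁) :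
    ∃ Q : (EuclideanSpace ℝ (Fin (n + 1))) ≃ₘ⟮𝓘(ℝ, (EuclideanSpace ℝ (Fin (n + 1)))), 𝓘(ℝ, (EuclideanSpace ℝ (Fin (n + 1))))⟯ (EuclideanSpace ℝ (Fin (n + 1))), (∀ x, ‖Q x‖ = ‖x‖) ∧
      ∀ x : (EuclideanSpace ℝ (Fin (n + 1))), ‖x‖ = 1 → c₀ ≤ ⟪(u : (EuclideanSpace ℝ (Fin (n + 1)))), x⟫ → Q (ι x) = x := by
  haveI : Fact (finrank ℝ (EuclideanSpace ℝ (Fin (n + 1))) = n + 1) := ⟨finrank_euclideanSpace_fin⟩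
  haveI : ConnectedSpace (sphere (0 : (EuclideanSpace ℝ (Fin (n + 1)))) 1) := by
    refine isConnected_iff_connectedSpace.mp (isConnected_sphere ?_ 0 zero_le_one)
    rw [← Module.finrank_eq_rank, finrank_euclideanSpace_fin]
    exact_mod_cast Nat.lt_add_of_pos_left (Nat.pos_of_ne_zero hn)
  -- a unit vector `v ⊥ u`
  obtain ⟨vs, hvs⟩ := exists_mem_sphere_inner_eq_zero hn u
  set v : (EuclideanSpace ℝ (Fin (n + 1))) := (vs : (EuclideanSpace ℝ (Fin (n + 1)))) with hvdef
  have hv : ‖v‖ = 1 := by simp [hvdef, norm_eq_of_mem_sphere]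
  have huv : ⟪(u : (EuclideanSpace ℝ (Fin (n + 1)))), v⟫ = 0 := hvs
  set Rv : (EuclideanSpace ℝ (Fin (n + 1))) ≃ₗᵢ[ℝ] (EuclideanSpace ℝ (Fin (n + 1))) := (ℝ ∙ v)ᗮ.reflection with hRv
  -- the cap embedding and the lift
  obtain ⟨j, L, hj, hjo, hjc₁, hjcap, hLdet, hjL⟩ := exists_capEmbedding u hv huv hc₁ hc hc₀
  have hjW : ∀ y, (j y : (EuclideanSpace ℝ (Fin (n + 1)))) ∈ W₁ := fun y => hcapW _ (by simp [norm_eq_of_mem_sphere]) (hjc₁ y)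
  obtain ⟨i, hi, hiι⟩ := exists_lift ι hsph hj hjW
  have hio : IsOpen (range i) := (hi.isLocalDiffeomorph_of_finrank_eq rfl).isOpen_range
  -- orientations
  obtain ⟨oM⟩ := (isOrientable_sphere_holds n : Nonempty (SmoothOrientation (𝓡 n) (sphere (0 : (EuclideanSpace ℝ (Fin (n + 1)))) 1)))
  obtain ⟨o₀, ho⟩ := exists_isOrientationPreserving_disc hj hjo oM
  -- points of the closed cap come from the closed disc
  have hcap : ∀ x : (EuclideanSpace ℝ (Fin (n + 1))), ‖x‖ = 1 → c₀ ≤ ⟪(u : (EuclideanSpace ℝ (Fin (n + 1)))), x⟫ → ∃ y, ‖y‖ ≤ 1 ∧ (j y : (EuclideanSpace ℝ (Fin (n + 1)))) = x := by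
    intro x hx1 hxc
    have : x ∈ (↑) '' (j '' closedBall (0 : EuclideanSpace ℝ (Fin n)) 1) := by rw [hjcap]; exact ⟨hx1, hxc⟩
    obtain ⟨_, ⟨y, hy, rfl⟩, hxy⟩ := this
    exact ⟨y, mem_closedBall_zero_iff.1 hy, hxy⟩
  -- the radial extension of a diffeotopy `D` with `D_1 = f` reads `f` on the sphere
  have hrad : ∀ (D : Diffeotopy (𝓡 n) (sphere (0 : (EuclideanSpace ℝ (Fin (n + 1)))) 1)) (f : sphere (0 : (EuclideanSpace ℝ (Fin (n + 1)))) 1 ≃ₘ⟮𝓡 n, 𝓡 n⟯ sphere (0 : (EuclideanSpace ℝ (Fin (n + 1)))) 1),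
      D.stage 1 = f → ∀ z : sphere (0 : (EuclideanSpace ℝ (Fin (n + 1)))) 1, D.radialExtension (z : (EuclideanSpace ℝ (Fin (n + 1)))) = (f z : (EuclideanSpace ℝ (Fin (n + 1)))) := by
    intro D f hD z
    rw [Diffeotopy.coe_radialExtension, radialExtensionFun_coe_sphere, ← Diffeotopy.coe_stage, hD]
  rcases isOrientationPreserving_or_isOrientationReversing_disc hi hio o₀ oM with hA | hB
  · -- Case A: `f ∘ î = j` on the disc
    obtain ⟨f, ⟨D, hD⟩, hfy⟩ := exists_isDiffeotopicToId_apply_disc_eq hi hj hA ho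
    refine ⟨D.radialExtension, fun x => by simp, fun x hx1 hxc => ?_⟩
    obtain ⟨y, hy, rfl⟩ := hcap x hx1 hxc
    rw [← hiι y, hrad D f hD, hfy y hy]
  · -- Case B: `f ∘ î ∘ L = j` on the disc, `f ∘ î = R_v` on the cap
    have hB' : IsOrientationPreserving (SmoothOrientation.modelSpace (-o₀)) oM i := by
      rw [← SmoothOrientation.neg_modelSpace, ← isOrientationReversing_iff_neg]; exact hB
    have h2 := isOrientationReversing_disc_comp hi hio hB' L (by rw [hLdet]; norm_num)
    rw [isOrientationReversing_iff_neg, ← SmoothOrientation.neg_modelSpace, neg_neg] at h2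
    have hi' : Manifold.IsSmoothEmbedding 𝓘(ℝ, EuclideanSpace ℝ (Fin n)) (𝓡 n) ∞ (i ∘ L) := by
      have h1 := hi.comp_diffeomorph L.toContinuousLinearEquiv.toDiffeomorph
      have he : (i ∘ ⇑(L.toContinuousLinearEquiv.toDiffeomorph)) = i ∘ L := by funext y; simp
      rwa [he] at h1
    obtain ⟨f, ⟨D, hD⟩, hfy⟩ := exists_isDiffeotopicToId_apply_disc_eq hi' hj h2 ho
    set RvD : (EuclideanSpace ℝ (Fin (n + 1))) ≃ₘ⟮𝓘(ℝ, (EuclideanSpace ℝ (Fin (n + 1)))), 𝓘(ℝ, (EuclideanSpace ℝ (Fin (n + 1))))⟯ (EuclideanSpace ℝ (Fin (n + 1))) := Rv.toContinuousLinearEquiv.toDiffeomorph with hRvD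
    refine ⟨D.radialExtension.trans RvD, fun x => ?_, fun x hx1 hxc => ?_⟩
    · show ‖Rv (D.radialExtension x)‖ = ‖x‖
      rw [LinearIsometryEquiv.norm_map]; simp
    · obtain ⟨y', hy', rfl⟩ := hcap x hx1 hxc
      set y := L.symm y' with hy
      have hyn : ‖y‖ ≤ 1 := by rw [hy, LinearIsometryEquiv.norm_map]; exact hy'
      have hLy : L y = y' := L.apply_symm_apply y'
      show Rv (D.radialExtension (ι (j y' : (EuclideanSpace ℝ (Fin (n + 1)))))) = (j y' : (EuclideanSpace ℝ (Fin (n + 1))))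
      rw [← hiι y', ← hLy, hrad D f hD, show i (L y) = (i ∘ L) y from rfl, hfy y hyn]
      -- `R_v (j y) = j (L y)` by equivariance
      rw [← hjL y]

/-! ### §5 The cap germ alignment -/

/-- A diffeomorphism of `ℝⁿ⁺¹` has injective derivative everywhere. [folklore] -/
theorem injective_fderiv_diffeomorph (T : (EuclideanSpace ℝ (Fin (n + 1))) ≃ₘ⟮𝓘(ℝ, (EuclideanSpace ℝ (Fin (n + 1)))), 𝓘(ℝ, (EuclideanSpace ℝ (Fin (n + 1))))⟯ (EuclideanSpace ℝ (Fin (n + 1)))) (x : (EuclideanSpace ℝ (Fin (n + 1)))) :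
    Injective (fderiv ℝ T x) := by
  have hT : ContDiff ℝ ∞ (T : (EuclideanSpace ℝ (Fin (n + 1))) → (EuclideanSpace ℝ (Fin (n + 1)))) := contMDiff_iff_contDiff.1 T.contMDiff
  have hS : ContDiff ℝ ∞ (T.symm : (EuclideanSpace ℝ (Fin (n + 1))) → (EuclideanSpace ℝ (Fin (n + 1)))) := contMDiff_iff_contDiff.1 T.symm.contMDiff
  have h1 : HasFDerivAt (T : (EuclideanSpace ℝ (Fin (n + 1))) → (EuclideanSpace ℝ (Fin (n + 1)))) (fderiv ℝ T x) x := ((hT.differentiable (by simp)) x).hasFDerivAt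
  have h2 : HasFDerivAt (T.symm : (EuclideanSpace ℝ (Fin (n + 1))) → (EuclideanSpace ℝ (Fin (n + 1)))) (fderiv ℝ T.symm (T x)) (T x) :=
    ((hS.differentiable (by simp)) (T x)).hasFDerivAt
  have hcomp := h2.comp x h1
  have hid : ((T.symm : (EuclideanSpace ℝ (Fin (n + 1))) → (EuclideanSpace ℝ (Fin (n + 1)))) ∘ (T : (EuclideanSpace ℝ (Fin (n + 1))) → (EuclideanSpace ℝ (Fin (n + 1))))) = id := funext fun z => T.symm_apply_apply z
  rw [hid] at hcomp
  have heq := hcomp.fderiv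
  rw [fderiv_id] at heq
  intro a b hab
  have ha := congrArg (fun S : (EuclideanSpace ℝ (Fin (n + 1))) →L[ℝ] (EuclideanSpace ℝ (Fin (n + 1))) => S a) heq
  have hb := congrArg (fun S : (EuclideanSpace ℝ (Fin (n + 1))) →L[ℝ] (EuclideanSpace ℝ (Fin (n + 1))) => S b) heq
  simp only [ContinuousLinearMap.coe_id', id_eq, ContinuousLinearMap.coe_comp, comp_apply] at ha hb
  rw [ha, hb, hab]


/-- **Cap germ alignment.**  Let `ι` be a diffeomorphism of `ℝⁿ⁺¹` (`n ≠ 0`) which, on an open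
set `W₁` containing the cap `{‖x‖ = 1, ⟪u, x⟫ > c₁}`, maps the unit sphere into the unit sphere
and the open unit ball into itself.  Then for `c₁ < c₀ < c_K < c_K' < 1` there is a map `Λ`,
smooth and injective on an open `O ⊇ 𝔻̄ⁿ⁺¹` with open image `⊇ 𝔻̄ⁿ⁺¹` and smooth inverse,
carrying the open ball onto itself and the sphere into itself, which **agrees with `ι` at the
points of `O` of norm `> 1 - δ` in the cone `{⟪u, x⟫ ≥ c_K' ‖x‖}`**.  Proof: undo `ι` on the
closed cap `c₀` by a norm-preserving diffeomorphism `Q` (`exists_normPreserving_apply_eq`),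
blend `Q ∘ ι` with the identity along the sphere and extend over the ball
(`CapBlend.exists_ballPreserving_extension`), and compose back with `Q⁻¹`.  This is the
"standard model of a neighbourhood" of Schultens' Lemma 3.2.3 (2014, PDF pp. 42–43), relative to
a boundary disc. [cite: HirschDT1976, Ch. 8 §1 Thm. 1.8, §3 Thm. 3.1] -/
theorem exists_alignment (hn : n ≠ 0) (u : sphere (0 : (EuclideanSpace ℝ (Fin (n + 1)))) 1) {c₁ c₀ cK cK' : ℝ}
    (hc₁ : -1 < c₁) (h₀ : c₁ < c₀) (hK : c₀ < cK) (hK' : cK < cK') (hcK' : cK' < 1)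
    (ι : (EuclideanSpace ℝ (Fin (n + 1))) ≃ₘ⟮𝓘(ℝ, (EuclideanSpace ℝ (Fin (n + 1)))), 𝓘(ℝ, (EuclideanSpace ℝ (Fin (n + 1))))⟯ (EuclideanSpace ℝ (Fin (n + 1)))) {W₁ : Set (EuclideanSpace ℝ (Fin (n + 1)))} (hW₁ : IsOpen W₁)
    (hsph : ∀ x ∈ W₁, ‖x‖ = 1 → ‖ι x‖ = 1) (hin : ∀ x ∈ W₁, ‖x‖ < 1 → ‖ι x‖ < 1)
    (hcapW : ∀ x : (EuclideanSpace ℝ (Fin (n + 1))), ‖x‖ = 1 → c₁ < ⟪(u : (EuclideanSpace ℝ (Fin (n + 1)))), x⟫ → x ∈ W₁) :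
    ∃ (Λ Λinv : (EuclideanSpace ℝ (Fin (n + 1))) → (EuclideanSpace ℝ (Fin (n + 1)))) (O : Set (EuclideanSpace ℝ (Fin (n + 1)))) (δ : ℝ), IsOpen O ∧ 0 < δ ∧ closedBall (0 : (EuclideanSpace ℝ (Fin (n + 1)))) 1 ⊆ O ∧
      (∀ x : (EuclideanSpace ℝ (Fin (n + 1))), |‖x‖ - 1| < δ → x ∈ O) ∧
      ContDiffOn ℝ ∞ Λ O ∧ InjOn Λ O ∧ IsOpen (Λ '' O) ∧ closedBall (0 : (EuclideanSpace ℝ (Fin (n + 1)))) 1 ⊆ Λ '' O ∧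
      ContDiffOn ℝ ∞ Λinv (Λ '' O) ∧ (∀ x ∈ O, Λinv (Λ x) = x) ∧
      Λ '' ball (0 : (EuclideanSpace ℝ (Fin (n + 1)))) 1 = ball 0 1 ∧ (∀ x : (EuclideanSpace ℝ (Fin (n + 1))), ‖x‖ = 1 → ‖Λ x‖ = 1) ∧
      (∀ x ∈ O, 1 - δ < ‖x‖ → x ≠ 0 → cK' ≤ ⟪(u : (EuclideanSpace ℝ (Fin (n + 1)))), x⟫ / ‖x‖ → Λ x = ι x) := by
  have hc₀1 : c₀ < 1 := by linarith
  obtain ⟨Q, hQn, hQ⟩ := exists_normPreserving_apply_eq hn u hc₁ h₀ hc₀1 ι hsph hcapW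
  have hQsn : ∀ y, ‖Q.symm y‖ = ‖y‖ := fun y => by
    conv_rhs => rw [← Q.apply_symm_apply y]
    rw [hQn]
  -- the blended map `ι₂ = Q ∘ ι` and its data
  set ι₂ : (EuclideanSpace ℝ (Fin (n + 1))) → (EuclideanSpace ℝ (Fin (n + 1))) := fun x => Q (ι x) with hι₂
  have hι₂s : ContDiff ℝ ∞ ι₂ := by
    rw [← contMDiff_iff_contDiff]; exact Q.contMDiff.comp ι.contMDiff
  have hι₂D : ∀ x, Injective (fderiv ℝ ι₂ x) := fun x => injective_fderiv_diffeomorph (ι.trans Q) x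
  -- the open set `W₂` on which `ι₂` is the identity of the sphere
  set W₂ : Set (EuclideanSpace ℝ (Fin (n + 1))) := {x | x ∈ W₁ ∧ x ≠ 0 ∧ c₀ < ⟪(u : (EuclideanSpace ℝ (Fin (n + 1)))), x⟫ / ‖x‖} with hW₂
  have hci : Continuous fun x : (EuclideanSpace ℝ (Fin (n + 1))) => ⟪(u : (EuclideanSpace ℝ (Fin (n + 1)))), x⟫ := continuous_const.inner continuous_id
  have hcont : ContinuousOn (fun x : (EuclideanSpace ℝ (Fin (n + 1))) => ⟪(u : (EuclideanSpace ℝ (Fin (n + 1)))), x⟫ / ‖x‖) {0}ᶜ :=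
    hci.continuousOn.div continuous_norm.continuousOn fun x hx => norm_ne_zero_iff.2 hx
  have hW₂o : IsOpen W₂ := by
    have h1 : IsOpen {x : (EuclideanSpace ℝ (Fin (n + 1))) | x ≠ 0 ∧ c₀ < ⟪(u : (EuclideanSpace ℝ (Fin (n + 1)))), x⟫ / ‖x‖} := by
      have := hcont.isOpen_inter_preimage isOpen_compl_singleton (isOpen_Ioi (a := c₀))
      have heq : {x : (EuclideanSpace ℝ (Fin (n + 1))) | x ≠ 0 ∧ c₀ < ⟪(u : (EuclideanSpace ℝ (Fin (n + 1)))), x⟫ / ‖x‖} = {0}ᶜ ∩ (fun x : (EuclideanSpace ℝ (Fin (n + 1))) => ⟪(u : (EuclideanSpace ℝ (Fin (n + 1)))), x⟫ / ‖x‖) ⁻¹' Ioi c₀ := by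
        ext x; simp only [mem_setOf_eq, mem_inter_iff, mem_compl_iff, mem_singleton_iff, mem_preimage, mem_Ioi]
      rw [heq]; exact this
    have : W₂ = W₁ ∩ {x : (EuclideanSpace ℝ (Fin (n + 1))) | x ≠ 0 ∧ c₀ < ⟪(u : (EuclideanSpace ℝ (Fin (n + 1)))), x⟫ / ‖x‖} := by
      ext x; simp only [hW₂, mem_setOf_eq, mem_inter_iff]
    rw [this]; exact hW₁.inter h1
  have hid₂ : ∀ x ∈ W₂, ‖x‖ = 1 → ι₂ x = x := by
    rintro x ⟨-, -, hxc⟩ hx1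
    rw [hx1, div_one] at hxc
    exact hQ x hx1 hxc.le
  have hin₂ : ∀ x ∈ W₂, ‖x‖ < 1 → ‖ι₂ x‖ < 1 := by
    rintro x ⟨hxW, -, -⟩ hx
    show ‖Q (ι x)‖ < 1
    rw [hQn]; exact hin x hxW hx
  -- the compact `K` and the cutoff
  set K : Set (EuclideanSpace ℝ (Fin (n + 1))) := {x | ‖x‖ = 1 ∧ cK ≤ ⟪(u : (EuclideanSpace ℝ (Fin (n + 1)))), x⟫} with hKdef
  have hKc : IsCompact K := by
    have hcl : IsClosed K := (isClosed_eq continuous_norm continuous_const).inter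
      (isClosed_le continuous_const hci)
    exact (isCompact_sphere (0 : (EuclideanSpace ℝ (Fin (n + 1)))) 1).of_isClosed_subset hcl fun x hx => mem_sphere_zero_iff_norm.2 hx.1
  have hKW : K ⊆ W₂ := by
    rintro x ⟨hx1, hxc⟩
    refine ⟨hcapW x hx1 (by linarith), by rintro rfl; simp at hx1, ?_⟩
    rw [hx1, div_one]; linarith
  set ψ : ℝ → ℝ := fun t => Real.smoothTransition ((t - cK) / (cK' - cK)) with hψ
  have hψs : ContDiff ℝ ∞ ψ := Real.smoothTransition.contDiff.comp ((contDiff_id.sub contDiff_const).div_const _)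
  set ρ : (EuclideanSpace ℝ (Fin (n + 1))) → ℝ := fun x => ψ (⟪(u : (EuclideanSpace ℝ (Fin (n + 1)))), x⟫ / ‖x‖) with hρdef
  have hρs : ContDiffOn ℝ ∞ ρ {0}ᶜ := by
    refine hψs.comp_contDiffOn ?_
    exact (contDiff_const.inner ℝ contDiff_id).contDiffOn.div (contDiffOn_id.norm ℝ fun x hx => hx)
      fun x hx => norm_ne_zero_iff.2 hx
  have hρ01 : ∀ x, ρ x ∈ Icc (0 : ℝ) 1 := fun x =>
    ⟨Real.smoothTransition.nonneg _, Real.smoothTransition.le_one _⟩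
  have hρ1 : ∀ x : (EuclideanSpace ℝ (Fin (n + 1))), x ≠ 0 → cK' ≤ ⟪(u : (EuclideanSpace ℝ (Fin (n + 1)))), x⟫ / ‖x‖ → ρ x = 1 := fun x hx h =>
    Real.smoothTransition.one_of_one_le ((one_le_div (by linarith)).2 (by linarith))
  have hρK : ∀ x : (EuclideanSpace ℝ (Fin (n + 1))), x ≠ 0 → ρ x ≠ 0 → ‖x‖⁻¹ • x ∈ K := by
    intro x hx hρx
    have ht : cK < ⟪(u : (EuclideanSpace ℝ (Fin (n + 1)))), x⟫ / ‖x‖ := by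
      by_contra hle
      push Not at hle
      exact hρx (Real.smoothTransition.zero_of_nonpos (div_nonpos_of_nonpos_of_nonneg (by linarith) (by linarith)))
    refine ⟨norm_smul_inv_norm (𝕜 := ℝ) hx, ?_⟩
    rw [inner_smul_right, ← div_eq_inv_mul]
    exact ht.le
  -- the extension
  obtain ⟨Λ₀, Λinv₀, O, δ, hOo, hδ, hcb, hshell, hΛ₀s, hinj, himo, hcbim, hΛinvs, hleft, himball, hsphid, hgerm⟩ :=
    CapBlend.exists_ballPreserving_extension hW₂o hid₂ hin₂ hι₂s hι₂D hρs hρ01 hKc hKW hρK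
  -- compose back with `Q⁻¹`
  refine ⟨fun x => Q.symm (Λ₀ x), fun y => Λinv₀ (Q y), O, δ, hOo, hδ, hcb, hshell, ?_, ?_, ?_, ?_, ?_, ?_, ?_, ?_, ?_⟩
  · exact (contMDiff_iff_contDiff.1 Q.symm.contMDiff).comp_contDiffOn hΛ₀s
  · intro x hx y hy hxy
    exact hinj hx hy (Q.symm.injective hxy)
  · have : (fun x => Q.symm (Λ₀ x)) '' O = Q.symm '' (Λ₀ '' O) := by rw [← image_comp]; rfl
    rw [this]; exact Q.symm.toHomeomorph.isOpenMap _ himo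
  · have : (fun x => Q.symm (Λ₀ x)) '' O = Q.symm '' (Λ₀ '' O) := by rw [← image_comp]; rfl
    rw [this]
    intro y hy
    refine ⟨Q y, hcbim ?_, Q.symm_apply_apply y⟩
    rw [mem_closedBall, dist_zero_right, hQn]; exact mem_closedBall_zero_iff.1 hy
  · have himg : (fun x => Q.symm (Λ₀ x)) '' O = Q.symm '' (Λ₀ '' O) := by rw [← image_comp]; rfl
    rw [himg]
    have hQs : ContDiff ℝ ∞ (Q : (EuclideanSpace ℝ (Fin (n + 1))) → (EuclideanSpace ℝ (Fin (n + 1)))) := contMDiff_iff_contDiff.1 Q.contMDiff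
    refine hΛinvs.comp hQs.contDiffOn fun y hy => ?_
    obtain ⟨z, hz, rfl⟩ := hy
    rw [Q.apply_symm_apply]; exact hz
  · intro x hx
    show Λinv₀ (Q (Q.symm (Λ₀ x))) = x
    rw [Q.apply_symm_apply]; exact hleft x hx
  · have : (fun x => Q.symm (Λ₀ x)) '' ball (0 : (EuclideanSpace ℝ (Fin (n + 1)))) 1 = Q.symm '' (Λ₀ '' ball 0 1) := by rw [← image_comp]; rfl
    rw [this, himball]
    ext y
    constructor
    · rintro ⟨z, hz, rfl⟩
      rw [mem_ball_zero_iff, hQsn]; exact mem_ball_zero_iff.1 hz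
    · intro hy
      exact ⟨Q y, by rw [mem_ball_zero_iff, hQn]; exact mem_ball_zero_iff.1 hy, Q.symm_apply_apply y⟩
  · intro x hx
    show ‖Q.symm (Λ₀ x)‖ = 1
    rw [hQsn, hsphid x hx, hx]
  · intro x hx hxn hx0 hxc
    show Q.symm (Λ₀ x) = ι x
    rw [hgerm x hx hxn, hρ1 x hx0 hxc, one_smul, add_sub_cancel]
    exact Q.symm_apply_apply (ι x)

end CapGermAlignment

end Literature.Topology.FourManifolds

end
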